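import Summits.BirchSwinnertonDyer.Rank1Residual.Additive.RamifiedTwistKodairaSymbol
import Literature.NumberTheory.DiophantineGeometry.TateAlgorithmIstarNonzeroProofs
import Literature.NumberTheory.DiophantineGeometry.TateAlgorithmTameTypesOddProofs
import Literature.NumberTheory.DiophantineGeometry.TateAlgorithmTranslationsProofs
import Literature.NumberTheory.DiophantineGeometry.TateAlgorithmAdditiveProofs
import Literature.NumberTheory.DiophantineGeometry.MinimalDiscriminantNormProofs
import Literature.NumberTheory.EllipticCurves.QuadraticTwistPadicReduction
import Literature.NumberTheory.EllipticCurves.RootNumberProofs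
import Literature.NumberTheory.EllipticCurves.GlobalMinimalModelProofs
import Literature.NumberTheory.EllipticCurves.OggFormulaTypeIstarProofs
import Literature.NumberTheory.EllipticCurves.QuadraticTwistJInvariantProofs
import HarnessLib

/-!
# Additive classes X3/X4: Kodaira type `I₀*` at an odd prime ⟹ the ramified quadratic twist is GOOD
# (Tate's algorithm Step 6 read backwards), and the census bits that single out `I₀*`

HONEST FRAMING (cell `b2b-bsdres`, run/shared/lean/b2b/bsd-rank1-residual/, verbatim in every
file): the goal of the cell is to DELETE the COMBINATION-SHAPED residual classes of the
Birch–Swinnerton-Dyer formula for ALL analytic-rank `≤ 1` elliptic curves over `ℚ` — "full BSD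
formula for every rank `≤ 1` curve in class `C`" assembled STRICTLY from published theorems — so
that the rank-`≤ 1` remainder becomes exactly the CONSTRUCTION-SHAPED classes, which are TYPED
(missing-input `Prop`s), NOT attempted. This is not "finishing BSD". Sub-cell `additive-p2`
(CLASS-OWNERS row "X3/X4 additive — pot. good ordinary / X3♯(G-ord)"), generation 8: research
route; no claim beyond the stated classes; theorems only, no definition, no named fact;
X3♯(G-ord)/X4♯(G-ord) stay CONSTRUCTION-SHAPED; labels / census / located gap UNCHANGED.

WHAT THIS FILE DOES (ELEMENTARY local arithmetic of Weierstrass equations, assembled from the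
tree's Tate algorithm `TateAlgorithm*` and its API; consumer: `SubGordThree.lean`, the census
currency `SubGord W 3 ↔ TypeG W 3` of the sub-cell's dictionary at `p = 3`).

[Revision, same generation: §0's `quadraticTwist_smul` and §1's twist theorem turned out to be in
the tree already, in greater generality — `WeierstrassCurve.quadraticTwist_smul`
(`QuadraticTwistJInvariantProofs`) and
`WeierstrassCurve.hasGoodReductionAt_quadraticTwist_of_kodairaSymbolAt_eq_Istar_zero`
(`OggFormulaTypeIstarProofs`: any Dedekind `A`, place `v ∤ 2`, uniformiser `π`); the statements
below are kept (consumer `SubGordThree.lean`) and are now one-line corollaries of those.]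

* §0 `quadraticTwist_smul` — `(C • W)^{(d)} = (u, d·r, 0, 0) • W^{(d)}` (twisting commutes with a
  change of variables up to an explicit one; = the tree's `WeierstrassCurve.quadraticTwist_smul`); `hasGoodReductionAt_of_integralModel`,
  `hasGoodReductionAt_of_valued_smul` — good reduction at `v` from ANY `K_v`-model with integral
  coefficients and unit discriminant (the converse of the tree's
  `exists_integralModel_of_hasGoodReductionAt`; Silverman *AEC* VII.1 Rem. 1.1, VII.5.1(a)).
* §1 **`hasGoodReductionAt_quadraticTwist_of_kodairaSymbolAt_eq_Istar_zero`** — for `E/ℚ` (any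
  equation `W`) of Kodaira type `I₀*` at the place `v` over an ODD prime `ℓ` and `D ∈ ℤ` with
  `ℓ ∥ D`: the twist `W^{(D)}` has GOOD reduction at `v`. The output `I₀*` means Step 6 of Tate's
  algorithm fired (`kodairaSymbolOfMinimal_eq_Istar_zero_imp`); the Step-2/Step-6 translations
  (`exists_variableChange_step2/6_of_perfectField`) give a model `W₆` with `π ∣ a₁, a₂`,
  `π² ∣ a₃, a₄`, `π³ ∣ a₆` and `ord Δ = 6` (`addVal_Δ_toNat_eq_six_…`, `2 ∈ 𝒪_vˣ`); then
  `(D, 0, 0, 0) • W₆^{(D)} = ⟨0, b₂/(4D), 0, b₄/(2D²), b₆/(4D³)⟩` is `v`-integral with discriminant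
  `Δ/D⁶ ∈ 𝒪_vˣ`. This is the CONVERSE of additive-p4's `kodairaSymbolAt_twist_of_semistable` (good
  case): classically "`I₀*` at `p` odd is the ramified quadratic twist of good reduction"
  (Silverman *ATAEC* Ex. 4.49; Comalada, J. Number Theory 49 (1994) §2). PROOF: the tree's
  `WeierstrassCurve.hasGoodReductionAt_quadraticTwist_of_kodairaSymbolAt_eq_Istar_zero` (bsd.S15's
  Ogg-formula file, same argument over any Dedekind domain) at `π = D`, `ord_v(D) = 1`.
* §2 **`kodairaSymbolAt_eq_Istar_zero_of_conductorExponent_eq_two`** — at an odd place: additive,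
  `f_v = 2` (the tree's `conductorExponent` IS Ogg's formula `ord_v Δ_min + 1 − m_v`),
  `6 ∣ ord_v Δ_min` and `ord_v j ≥ 0` force the type `I₀*` (Table 4.1: the additive types have
  `m_v ∈ {1, 2, 3, n + 5, 7, 8, 9}`; `Iₙ*`, `n ≥ 1`, has `ord_v j < 0`).

References: J. Tate, *Algorithm for determining the type of a singular fiber in an elliptic
pencil*, LNM 476 (1975) §§7–8; J. H. Silverman, *ATAEC* IV.9.4 (Steps 2, 6), Table 4.1, IV.11.1,
Ex. 4.49; *AEC* III.1 Table 3.1, VII.1 Rem. 1.1, VII.5 Prop. 5.1; S. Comalada, J. Number Theory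
49 (1994) §2.
-/

noncomputable section

open scoped Classical

open Polynomial IsLocalRing IsDedekindDomain IsDedekindDomain.HeightOneSpectrum NumberField
  Rat.HeightOneSpectrum WeierstrassCurve
  Literature.NumberTheory.DiophantineGeometry
  Literature.NumberTheory.DiophantineGeometry.TateAlgorithm
  Literature.NumberTheory.EllipticCurves

namespace Summit.BirchSwinnertonDyer.Rank1Residual.Additive

/-! ### §0 Two model-bookkeeping lemmas -/

section Field

variable {F : Type*} [Field F] (W : WeierstrassCurve F)

/-- **Twisting commutes with a change of variables up to an explicit change of variables**: for
`C = (u, r, s, t)`, `(C • W)^{(d)} = (u, d·r, 0, 0) • W^{(d)}` on the nose (the twist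
`⟨0, d b₂/4, 0, d² b₄/2, d³ b₆/4⟩` only sees the `b`-invariants, which transform by
`b₂ ↦ u⁻²(b₂ + 12r)`, `b₄ ↦ u⁻⁴(b₄ + rb₂ + 6r²)`, `b₆ ↦ u⁻⁶(b₆ + 2rb₄ + r²b₂ + 4r³)`;
Silverman *AEC* III.1 Table 3.1). [folklore] -/
theorem quadraticTwist_smul (h2 : (2 : F) ≠ 0) (C : VariableChange F) (d : F) :
    (C • W).quadraticTwist d = (⟨C.u, d * C.r, 0, 0⟩ : VariableChange F) • W.quadraticTwist d := by
  haveI : NeZero (2 : F) := ⟨h2⟩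
  exact WeierstrassCurve.quadraticTwist_smul W C d

end Field

section Intro

variable {K : Type*} [Field K] [NumberField K] (W : WeierstrassCurve K) (v : HeightOneSpectrum (𝓞 K))

/-- **Good reduction from an integral model over the completion.** If some change of variables
over `K_v` carries `W_{K_v}` to (the base change of) a Weierstrass equation over `𝒪_v` with UNIT
discriminant, then `W` has good reduction at `v` (that equation is minimal, Silverman *AEC* VII.1
Rem. 1.1, and good reduction is read on any minimal model, VII.5 Prop. 5.1(a); tree
`isMinimal_of_valuation_Δ_eq_one`, `hasGoodReduction_iff_of_isMinimal_of_eq_smul`). The converse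
of the tree's `exists_integralModel_of_hasGoodReductionAt`. [folklore] -/
theorem hasGoodReductionAt_of_integralModel (C : VariableChange (v.adicCompletion K))
    (M : WeierstrassCurve (v.adicCompletionIntegers K))
    (hCM : C • W.baseChange (v.adicCompletion K) =
      M.map (algebraMap (v.adicCompletionIntegers K) (v.adicCompletion K)))
    (hΔ : IsUnit M.Δ) : W.HasGoodReductionAt v := by
  haveI hSint : (C • W.baseChange (v.adicCompletion K)).IsIntegral (v.adicCompletionIntegers K) :=
    ⟨⟨M, by rw [hCM]; rfl⟩⟩
  have hΔS : valuation (v.adicCompletion K)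
      (IsDiscreteValuationRing.maximalIdeal (v.adicCompletionIntegers K))
      (C • W.baseChange (v.adicCompletion K)).Δ = 1 := by
    rw [hCM, map_Δ, HeightOneSpectrum.valuation_eq_one_iff_notMem]
    exact fun hm ↦ ((IsLocalRing.mem_maximalIdeal _).mp hm) hΔ
  haveI hSmin : (C • W.baseChange (v.adicCompletion K)).IsMinimal (v.adicCompletionIntegers K) :=
    isMinimal_of_valuation_Δ_eq_one _ hΔS
  have hSgood : (C • W.baseChange (v.adicCompletion K)).HasGoodReduction
      (v.adicCompletionIntegers K) := ⟨hΔS⟩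
  obtain ⟨D, hD⟩ : ∃ D : VariableChange (v.adicCompletion K),
      W.localMinimalModel v = D • W.baseChange (v.adicCompletion K) := ⟨_, rfl⟩
  have h : W.localMinimalModel v = (D * C⁻¹) • (C • W.baseChange (v.adicCompletion K)) := by
    rw [hD, mul_smul, inv_smul_smul]
  exact (hasGoodReduction_iff_of_isMinimal_of_eq_smul (v.adicCompletionIntegers K) h).mpr hSgood

end Intro

/-! ### §1 `I₀*` at an odd place ⟹ the twist by a uniformiser is GOOD (Tate's algorithm Step 6, read backwards) -/

section IstarZero

variable (v : HeightOneSpectrum (𝓞 ℚ)) (W : WeierstrassCurve ℚ) [W.IsElliptic]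

/-- The residue ring of `𝓞 ℚ` at the place `v` over `ℓ` has characteristic `ℓ`
(verbatim from additive-p4's `RamifiedTwistConductor.lean`). [folklore] -/
private theorem ringChar_quot_asIdeal_eq : ringChar (𝓞 ℚ ⧸ v.asIdeal) = (primesEquiv v : ℕ) := by
  have hp : (primesEquiv v : ℕ).Prime := (primesEquiv v).2
  have hmem : ((primesEquiv v : ℕ) : 𝓞 ℚ) ∈ v.asIdeal :=
    (natCast_mem_asIdeal_iff_eq_primesEquiv_symm v hp).mpr (by simp)
  haveI : Nontrivial (𝓞 ℚ ⧸ v.asIdeal) := Ideal.Quotient.nontrivial_iff.mpr v.isPrime.ne_top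
  apply CharP.ringChar_of_prime_eq_zero hp
  rw [← map_natCast (Ideal.Quotient.mk v.asIdeal), Ideal.Quotient.eq_zero_iff_mem]
  exact hmem

omit [W.IsElliptic] in
/-- A variant of `hasGoodReductionAt_of_integralModel` with the integral model given by valuations:
if `C • W_{ℚ_v}` has `v(aᵢ) ≤ 1` and `v(Δ) = 1` then `W` is good at `v`. [folklore] -/
theorem hasGoodReductionAt_of_valued_smul (C : VariableChange (v.adicCompletion ℚ))
    (h₁ : Valued.v (C • W.baseChange (v.adicCompletion ℚ)).a₁ ≤ 1)
    (h₂ : Valued.v (C • W.baseChange (v.adicCompletion ℚ)).a₂ ≤ 1)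
    (h₃ : Valued.v (C • W.baseChange (v.adicCompletion ℚ)).a₃ ≤ 1)
    (h₄ : Valued.v (C • W.baseChange (v.adicCompletion ℚ)).a₄ ≤ 1)
    (h₆ : Valued.v (C • W.baseChange (v.adicCompletion ℚ)).a₆ ≤ 1)
    (hΔ : Valued.v (C • W.baseChange (v.adicCompletion ℚ)).Δ = 1) :
    W.HasGoodReductionAt v := by
  set S := C • W.baseChange (v.adicCompletion ℚ) with hSdef
  have mem : ∀ x : v.adicCompletion ℚ, Valued.v x ≤ 1 →
      ∃ r : v.adicCompletionIntegers ℚ,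
        algebraMap (v.adicCompletionIntegers ℚ) (v.adicCompletion ℚ) r = x := fun x hx ↦
    ⟨⟨x, (HeightOneSpectrum.mem_adicCompletionIntegers (𝓞 ℚ) ℚ v).mpr hx⟩, rfl⟩
  haveI hSint : S.IsIntegral (v.adicCompletionIntegers ℚ) :=
    isIntegral_of_exists_lift _ (mem _ h₁) (mem _ h₂) (mem _ h₃) (mem _ h₄) (mem _ h₆)
  set M := S.integralModel (v.adicCompletionIntegers ℚ) with hMdef
  have hSM : S = M.map (algebraMap (v.adicCompletionIntegers ℚ) (v.adicCompletion ℚ)) :=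
    (baseChange_integralModel_eq (v.adicCompletionIntegers ℚ) S).symm
  refine hasGoodReductionAt_of_integralModel W v C M hSM ?_
  rw [HeightOneSpectrum.adicCompletionIntegers.isUnit_iff_valued_eq_one]
  have : ((M.Δ : v.adicCompletionIntegers ℚ) : v.adicCompletion ℚ) = S.Δ := by
    rw [hSM, map_Δ]; rfl
  rw [this, hΔ]

/-- **Tate's algorithm Step 6 read backwards: type `I₀*` at an odd place `v` makes the quadratic
twist by a uniformiser GOOD at `v`.** Let `E/ℚ` (any equation `W`) have Kodaira type `I₀*` at the
place `v` over an odd prime `ℓ`, and let `D ∈ ℤ` with `ℓ ∥ D`. Then the twist `W^{(D)}` has good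
reduction at `v`. Proof: on the local minimal model, the output `I₀*` means Step 6 fired
(`kodairaSymbolOfMinimal_eq_Istar_zero_imp`), so after the Step-2 and Step-6 translations
(`exists_variableChange_step2/6_of_perfectField`, `u = 1`) the model `W₆` has
`π ∣ a₁, a₂`, `π² ∣ a₃, a₄`, `π³ ∣ a₆`, hence `π ∣ b₂`, `π² ∣ b₄`, `π³ ∣ b₆`, and `ord Δ = 6`
(`addVal_Δ_toNat_eq_six_of_kodairaSymbolOfMinimal_eq_Istar_zero`, `2 ∈ 𝒪_vˣ`). The twisted
equation `W₆^{(D)} = ⟨0, Db₂/4, 0, D²b₄/2, D³b₆/4⟩` rescaled by `u = D` (`ord D = 1`) is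
`⟨0, b₂/(4D), 0, b₄/(2D²), b₆/(4D³)⟩` — `v`-integral — with discriminant `D⁶Δ/D¹² = Δ/D⁶`, a unit;
and `W₆^{(D)} ≅ W^{(D)}` over `ℚ_v` (`quadraticTwist_smul`, `map_quadraticTwist`). This is the
converse of additive-p4's `kodairaSymbolAt_twist_of_semistable` (good case); classically
"`I₀*` is the ramified quadratic twist of good reduction, `p` odd" (Silverman *ATAEC* Ex. 4.49;
Comalada, J. Number Theory 49 (1994) §2). [cite: SilvermanATAEC1994, IV.9.4 Step 6 (PDF p. 345)] -/
theorem hasGoodReductionAt_quadraticTwist_of_kodairaSymbolAt_eq_Istar_zero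
    (hv2 : (primesEquiv v : ℕ) ≠ 2) {D : ℤ}
    (h1 : ((primesEquiv v : ℕ) : ℤ) ∣ D) (h2 : ¬ ((primesEquiv v : ℕ) : ℤ) ^ 2 ∣ D)
    (hK : W.kodairaSymbolAt v = .Istar 0) :
    (W.quadraticTwist (D : ℚ)).HasGoodReductionAt v := by
  haveI : Finite (ResidueField (v.adicCompletionIntegers ℚ)) :=
    HeightOneSpectrum.finite_residueField_adicCompletionIntegers ℚ v
  haveI : PerfectField (ResidueField (v.adicCompletionIntegers ℚ)) := PerfectField.ofFinite
  have hchar2 : ringChar (𝓞 ℚ ⧸ v.asIdeal) ≠ 2 := by rw [ringChar_quot_asIdeal_eq v]; exact hv2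
  exact W.hasGoodReductionAt_quadraticTwist_of_kodairaSymbolAt_eq_Istar_zero v hchar2 hK
    (valuation_ringOfIntegers_intCast_eq_exp_neg_one v h1 h2)

end IstarZero

/-! ### §2 From the census bits to the Kodaira type `I₀*` (Ogg's formula, odd residue characteristic) -/

section CensusBits

variable (v : HeightOneSpectrum (𝓞 ℚ)) (W : WeierstrassCurve ℚ) [W.IsElliptic]

/-- **The census bits single out Kodaira type `I₀*`.** At a place `v` of odd residue
characteristic: additive reduction, conductor exponent `f_v = 2` (Ogg's formula
`f_v = ord_v Δ_min + 1 − m_v` is the tree's DEFINITION of `conductorExponent`), `6 ∣ ord_v Δ_min`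
(the census's `e = 12/gcd(12, ord_v Δ_min) ∣ 2`) and `ord_v j ≥ 0` (not potentially
multiplicative) force `W.kodairaSymbolAt v = I₀*`: additive types have `m_v ∈ {1,2,3,5+n,7,8,9}`
(Silverman *ATAEC* IV Table 4.1), `f_v = 2` gives `ord_v Δ_min = m_v + 1`, and `6 ∣ m_v + 1`
leaves `Iₙ*` with `6 ∣ n`; `n ≥ 1` is potentially multiplicative (`ord_v j = −n < 0`,
`one_lt_valuation_j_of_kodairaSymbolAt_eq_Istar_succ`). [cite: SilvermanATAEC1994, IV Table 4.1 (PDF p. 365) and IV.11.1] -/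
theorem kodairaSymbolAt_eq_Istar_zero_of_conductorExponent_eq_two (hv2 : (primesEquiv v : ℕ) ≠ 2)
    (hadd : W.HasAdditiveReductionAt v) (hf : W.conductorExponent v = 2)
    (h6 : 6 ∣ W.ordMinimalDiscriminant v) (hj : v.valuation ℚ W.j ≤ 1) :
    W.kodairaSymbolAt v = .Istar 0 := by
  haveI : Finite (ResidueField (v.adicCompletionIntegers ℚ)) :=
    HeightOneSpectrum.finite_residueField_adicCompletionIntegers ℚ v
  haveI : PerfectField (ResidueField (v.adicCompletionIntegers ℚ)) := PerfectField.ofFinite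
  have hchar2 : ringChar (𝓞 ℚ ⧸ v.asIdeal) ≠ 2 := by rw [ringChar_quot_asIdeal_eq v]; exact hv2
  have hk : (W.kodairaSymbolAt v).IsAdditive := (isAdditive_kodairaSymbolAt_iff_holds v W).mpr hadd
  unfold WeierstrassCurve.conductorExponent WeierstrassCurve.numComponentsAt at hf
  rcases hks : W.kodairaSymbolAt v with (_ | n) | _ | _ | _ | (_ | n) | _ | _ | _
  · exact absurd rfl (hks ▸ hk).1
  · exact absurd ⟨n + 1, n.succ_ne_zero, rfl⟩ (hks ▸ hk).2
  · rw [hks] at hf; simp only [KodairaSymbol.numComponents] at hf; omega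
  · rw [hks] at hf; simp only [KodairaSymbol.numComponents] at hf; omega
  · rw [hks] at hf; simp only [KodairaSymbol.numComponents] at hf; omega
  · rfl
  · exact absurd hj (not_le.mpr (one_lt_valuation_j_of_kodairaSymbolAt_eq_Istar_succ v W hchar2 hks))
  · rw [hks] at hf; simp only [KodairaSymbol.numComponents] at hf; omega
  · rw [hks] at hf; simp only [KodairaSymbol.numComponents] at hf; omega
  · rw [hks] at hf; simp only [KodairaSymbol.numComponents] at hf; omega

end CensusBits

end Summit.BirchSwinnertonDyer.Rank1Residual.Additive

end
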